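import Mathlib
import Summits.ValiantsHypothesis.ValiantsHypothesis.Theses.RigidityForcesSymmetry

/-!
# Crux idea `ghost-ledger` for `LaplaceOptimalFive` (stmt-ValiantsHypothesis-24813) — sketch (val-idea-19 g7)

HONEST LABEL.  `LaplaceOptimalFive` (= `LaplaceOptimal 5`: «every split decomposition of `P₅` has Laplace weight `≥ 120`»)
is OPEN · CONTESTED 72/120; nothing here proves it; `RankRigidMinimalRepr` (18034) does not move; VP ≠ VNP is NOT proved.

THE LEVER (configuration ideal and its ghosts).  Work in the slot-square-free algebra
`R = ℂ[x_{ia} : i, a ∈ Fin 5]/(x_{ia} x_{ib}) = ⊕_{A ⊆ [5]} V^{⊗A}` (`R_A` = functions of the words on the slots `A`; the product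
`R_A · R_B → R_{A ∪ B}` is the tensor product when `A ∩ B = ∅` and `0` otherwise).  A split term `u ⊗_S w` is the PRODUCT
`u · w` (`u ∈ R_S`, `w ∈ R_{Sᶜ}`), so a split decomposition `X = (S_t, u_t, w_t)_t` of `P₅` says exactly
`P₅ ∈ (J_X)_𝟙`, `J_X := (u_t : t) ⊆ R` the CONFIGURATION IDEAL, and the Laplace weight is the COST of this generating set
(`|S|!·(5-|S|)!` per generator of slot-degree `S`).  `LaplaceOptimalFive ⟺ every slot-homogeneous ideal `J ∋ P₅` has
`cost(J) := Σ_A β_{0,A}(J)·|A|!(5-|A|)! ≥ 120` (weighted ZEROTH BETTI NUMBERS).  A BORDER decomposition `P₅ = lim_ε Σ u_t(ε) w_t(ε)`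
says `P₅ ∈ Ĵ_𝟙` for the FLAT LIMIT `Ĵ = ((J̃ : ε^∞) + (ε))/(ε) ⊋ J_{X(0)}`: the limit ideal acquires GHOST generators (lifted
syzygies of the limit configuration) — `β₀` JUMPS UP.  Honest ⟺ no ghosts.  The non-closed invariant separating the border classes
from honest decompositions is the ghost profile `γ_A = β_{0,A}(Ĵ) − β_{0,A}(J_{X(0)})`; «exactly true, border false» ⟺ «`P₅` is
reachable below cost 120 only through syzygy-born generators».

CONTENTS (all kernel facts by `decide` over `ℤ`; the p629937 star border family in the normal form of `ArcHeightSketch`: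
eight pole terms `(a_t + ε b_t) ⊗ (p_t + ε q_t)` on the slot pairs `01,01,02,02,03,03,04,04`, `a = (E,N,E,N,E,N,E,N)`,
`b = (0,0,M,M,M,−M,−M/2,0)`, ninth term `ε·M₀₁ ⊗ Q₂₃₄`; LIMIT CONFIGURATION `X(0)`: `{E,N,M}` on `01`, `{E,N}` on `02,03,04`).
* §1 `cubic_collision` (`E₀₂·x₁₃ = E₀₁·x₂₃` in `R_{012}`), `ghost_identity` (`(E+εM)₀₂·x₁₃ − E₀₁·x₂₃ = ε·(M₀₂·x₁₃)` for every `ε`: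
  the cubic GHOST `g = M₀₂ ⊗ e₃⁽¹⁾` lies in `J(ε)` for all `ε ≠ 0`, hence in the flat limit), `psi_perp_limitIdeal` + `psi_ghost`
  (`g ∉ J_{X(0)}`: the functional `ψ = δ_{(2,3,4)}` kills `(J_{X(0)})_{012}` and `ψ(g) = 1`).
* §2 `phi_perp_0j` (`j = 1,2,3,4`) + `phi_pairs_P5` : the apolar witness `φ = [v injective ∧ v₀ ∈ {2,4} ∧ v₁ ∉ {2,4}]` kills
  `(J_{X(0)})_𝟙` and pairs to `36` with `P₅` — the naive limit configuration does NOT contain `P₅` (it is honest and cheap).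
* §3 `pointWitness_*` : a RANK-ONE apolar witness: the matrix `x` (row 0 `= e₄`, `x₁₂ = 0`) is a common zero of all nine limit
  short factors (as bilinear forms in the rows `x₀, x_j`) and `perm x = 18 ≠ 0`.
* §4 `hub_expansion_144` : `P₅ = Σ_{j=1..4} (E₀ⱼ⊗R + N₀ⱼ⊗U + M₀ⱼ⊗Q)` — the honest HUB expansion of weight `144`; the border family
  is this expansion with the three generators `M₀₂, M₀₃, M₀₄` (cost `36`) traded for cubic ghosts: `144 − 36 = 108`
  (the LEDGER of p629937).
* §5 `phi2_*` : sign-sensitivity — the weight-72 configuration `(θ₀; ω₀₁,…,ω₀₄)` of `…Negative.SignPatternCheap.sign_five_cheap`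
  contains `D₅` (`sign_five_hub_identity`, by name) but NOT `P₅`: `φ₂ = [v injective ∧ v₀ ≠ 4]` kills its degree-𝟙 part, pairs
  `96` with `P₅` and `0` with the Levi-Civita symbol.
* §6 `cubicGhost_rank` (PROVED over `ℂ`): a cubic collision `Σ_k p_k(a,b) x_k(c) = Σ_l q_l(a,c) y_l(b) ≠ 0` between short spaces
  on the splits `{h,i}`, `{h,j}` forces a non-zero element of `span p` of matrix rank `≤ #q` (ghosts are born on rank strata).
* §7 `laplaceOptimalFive_of_witnesses` (PROVED over `ℂ`): if every cheap cylindrical short configuration admits an APOLAR WITNESS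
  `Φ` (all contractions `u_t ⌟ Φ = 0`, `⟨Φ, P₅⟩ ≠ 0`) then `LaplaceOptimalFive`; `stub_witnesses_of_laplaceOptimalFive` (sorried,
  duality) is the converse — together the apolar-witness form of the crux, the gateway of the line.
-/

set_option linter.style.longLine false
set_option linter.unusedVariables false
set_option autoImplicit false
set_option linter.dupNamespace false

namespace Summit.ValiantsHypothesis.ValiantsHypothesis.Cruxes.LaplaceOptimalFive.GhostLedger

open Finset

/-! ### 0. Data: the limit configuration of the star border family (p629937 normal form) -/

/-- `E = e₀ ⊗ e₃` (short factor, any hub split `0j`). -/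
def sE (x y : Fin 5) : ℤ := if (x = 0 ∧ y = 3) then 1 else 0
/-- `N = e₁⊗e₃ + e₃⊗e₁`. -/
def sN (x y : Fin 5) : ℤ := if (x = 1 ∧ y = 3) ∨ (x = 3 ∧ y = 1) then 1 else 0
/-- `M = e₂⊗e₄ + e₄⊗e₂`. -/
def sM (x y : Fin 5) : ℤ := if (x = 2 ∧ y = 4) ∨ (x = 4 ∧ y = 2) then 1 else 0
/-- the slice variable `x_{·,3}` = `δ₃`. -/
def d3 (y : Fin 5) : ℤ := if y = 3 then 1 else 0
/-- `Q` = indicator of the arrangements of the letters `{0,1,3}`. -/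
def arrQ (x y z : Fin 5) : ℤ :=
  if (x = 0 ∧ y = 1 ∧ z = 3) ∨ (x = 0 ∧ y = 3 ∧ z = 1) ∨ (x = 1 ∧ y = 0 ∧ z = 3) ∨ (x = 1 ∧ y = 3 ∧ z = 0) ∨ (x = 3 ∧ y = 0 ∧ z = 1) ∨ (x = 3 ∧ y = 1 ∧ z = 0) then 1 else 0
/-- `R` = indicator of the arrangements of `{1,2,4}`. -/
def arrR (x y z : Fin 5) : ℤ :=
  if (x = 1 ∧ y = 2 ∧ z = 4) ∨ (x = 1 ∧ y = 4 ∧ z = 2) ∨ (x = 2 ∧ y = 1 ∧ z = 4) ∨ (x = 2 ∧ y = 4 ∧ z = 1) ∨ (x = 4 ∧ y = 1 ∧ z = 2) ∨ (x = 4 ∧ y = 2 ∧ z = 1) then 1 else 0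
/-- `U` = indicator of the arrangements of `{0,2,4}`. -/
def arrU (x y z : Fin 5) : ℤ :=
  if (x = 0 ∧ y = 2 ∧ z = 4) ∨ (x = 0 ∧ y = 4 ∧ z = 2) ∨ (x = 2 ∧ y = 0 ∧ z = 4) ∨ (x = 2 ∧ y = 4 ∧ z = 0) ∨ (x = 4 ∧ y = 0 ∧ z = 2) ∨ (x = 4 ∧ y = 2 ∧ z = 0) then 1 else 0
/-- `P₅` as an integer function of the five letters. -/
def pat5 (a b c d e : Fin 5) : ℤ :=
  if a ≠ b ∧ a ≠ c ∧ a ≠ d ∧ a ≠ e ∧ b ≠ c ∧ b ≠ d ∧ b ≠ e ∧ c ≠ d ∧ c ≠ e ∧ d ≠ e then 1 else 0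

/-! ### 1. The cubic collision of the limit configuration and its ghost -/

/-- COLLISION (kernel): in slot-degree `{0,1,2}` the generator multiples `E₀₂ · x_{1,3}` and `E₀₁ · x_{2,3}` coincide — the
multiplication maps out of the limit configuration are NOT injective modulo Koszul: the Hilbert function of `J_{X(0)}` drops
in a CUBIC degree. -/
theorem cubic_collision : ∀ x0 x1 x2 : Fin 5, sE x0 x2 * d3 x1 = sE x0 x1 * d3 x2 := by
  decide

/-- GHOST (kernel + `linear_combination`): along the family (`E + εM` on `02`, `E` on `01`) the collision lifts to
`(E + εM)₀₂ · x_{1,3} − E₀₁ · x_{2,3} = ε · (M₀₂ · x_{1,3})`, so `g := M₀₂ ⊗ e₃⁽¹⁾ ∈ J(ε)` for every `ε ≠ 0` and hence `g` lies in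
the flat limit `Ĵ` — a cubic generator of `Ĵ` born from a syzygy of `J_{X(0)}`. -/
theorem ghost_identity (ε : ℤ) : ∀ x0 x1 x2 : Fin 5,
    (sE x0 x2 + ε * sM x0 x2) * d3 x1 - sE x0 x1 * d3 x2 = ε * (sM x0 x2 * d3 x1) := by
  intro x0 x1 x2
  have h := cubic_collision x0 x1 x2
  linear_combination h

/-- the ghost `g = M₀₂ ⊗ e₃⁽¹⁾` as a function of the word on the slots `(0,1,2)`. -/
def ghost (x0 x1 x2 : Fin 5) : ℤ := sM x0 x2 * d3 x1

/-- the certificate `ψ = δ_{(2,3,4)}` on the slots `(0,1,2)`. -/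
def psi (x0 x1 x2 : Fin 5) : ℤ := if x0 = 2 ∧ x1 = 3 ∧ x2 = 4 then 1 else 0

/-- `ψ` annihilates the degree-`{0,1,2}` component of the limit configuration ideal `J_{X(0)}`: its generators there are
`E, N, M` on `{0,1}` times `V₂` and `E, N` on `{0,2}` times `V₁`; pairing against `u ⊗ e_c` is the displayed double sum (kernel). -/
theorem psi_perp_limitIdeal :
    (∀ c : Fin 5, (∑ x0 : Fin 5, ∑ x1 : Fin 5, psi x0 x1 c * sE x0 x1) = 0 ∧ (∑ x0 : Fin 5, ∑ x1 : Fin 5, psi x0 x1 c * sN x0 x1) = 0 ∧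
        (∑ x0 : Fin 5, ∑ x1 : Fin 5, psi x0 x1 c * sM x0 x1) = 0) ∧
    (∀ b : Fin 5, (∑ x0 : Fin 5, ∑ x2 : Fin 5, psi x0 b x2 * sE x0 x2) = 0 ∧ (∑ x0 : Fin 5, ∑ x2 : Fin 5, psi x0 b x2 * sN x0 x2) = 0) := by
  decide

/-- … while `ψ(g) = 1 ≠ 0`: the ghost is NOT in `J_{X(0)}` (kernel).  So `Ĵ ⊋ J_{X(0)}` already in a cubic degree:
`β₀` jumps at the border point. -/
theorem psi_ghost : (∑ x0 : Fin 5, ∑ x1 : Fin 5, ∑ x2 : Fin 5, psi x0 x1 x2 * ghost x0 x1 x2) = 1 := by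
  decide

/-! ### 2. The naive limit configuration does not contain `P₅` (apolar witness `φ`, pairing `36`) -/

/-- the apolar witness `φ = [v injective ∧ v₀ ∈ {2,4} ∧ v₁ ∉ {2,4}]`. -/
def phi (a b c d e : Fin 5) : ℤ := if (a = 2 ∨ a = 4) ∧ ¬ (b = 2 ∨ b = 4) then pat5 a b c d e else 0

/-- `φ ⊥ u ⊗ V^{⊗{2,3,4}}` for the three limit generators `u ∈ {E, N, M}` on the split `{0,1}` (kernel). -/
theorem phi_perp_01 : ∀ c d e : Fin 5,
    (∑ a : Fin 5, ∑ b : Fin 5, phi a b c d e * sE a b) = 0 ∧ (∑ a : Fin 5, ∑ b : Fin 5, phi a b c d e * sN a b) = 0 ∧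
      (∑ a : Fin 5, ∑ b : Fin 5, phi a b c d e * sM a b) = 0 := by
  decide

/-- `φ ⊥ u ⊗ V^{⊗{1,3,4}}` for `u ∈ {E, N}` on `{0,2}` (kernel). -/
theorem phi_perp_02 : ∀ b d e : Fin 5,
    (∑ a : Fin 5, ∑ c : Fin 5, phi a b c d e * sE a c) = 0 ∧ (∑ a : Fin 5, ∑ c : Fin 5, phi a b c d e * sN a c) = 0 := by
  decide

/-- `φ ⊥ u ⊗ V^{⊗{1,2,4}}` for `u ∈ {E, N}` on `{0,3}` (kernel). -/
theorem phi_perp_03 : ∀ b c e : Fin 5,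
    (∑ a : Fin 5, ∑ d : Fin 5, phi a b c d e * sE a d) = 0 ∧ (∑ a : Fin 5, ∑ d : Fin 5, phi a b c d e * sN a d) = 0 := by
  decide

/-- `φ ⊥ u ⊗ V^{⊗{1,2,3}}` for `u ∈ {E, N}` on `{0,4}` (kernel). -/
theorem phi_perp_04 : ∀ b c d : Fin 5,
    (∑ a : Fin 5, ∑ e : Fin 5, phi a b c d e * sE a e) = 0 ∧ (∑ a : Fin 5, ∑ e : Fin 5, phi a b c d e * sN a e) = 0 := by
  decide

set_option maxHeartbeats 4000000 in
/-- `⟨φ, P₅⟩ = 36 ≠ 0` (kernel): with `phi_perp_0j` this certifies `P₅ ∉ (J_{X(0)})_𝟙` — the limit configuration (nine honest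
pair generators, cost 108) does NOT contain `P₅`; the border family reaches `P₅` only through the ghosts of the flat limit. -/
theorem phi_pairs_P5 : (∑ a : Fin 5, ∑ b : Fin 5, ∑ c : Fin 5, ∑ d : Fin 5, ∑ e : Fin 5, phi a b c d e * pat5 a b c d e) = 36 := by
  decide

/-! ### 3. A rank-one apolar witness (point of the configuration's zero locus with non-zero permanent) -/

/-- the matrix `x`: row `0 = e₄`; rows `1..4` = all ones on the columns `0..3` except `x₁₂ = 0`; column `4` of rows `1..4` zero. -/
def xw (i a : Fin 5) : ℤ :=
  if i = 0 then (if a = 4 then 1 else 0) else (if a = 4 then 0 else if (i = 1 ∧ a = 2) then 0 else 1)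

/-- every limit short factor, read as a bilinear form in the rows of its two slots, VANISHES at `x` (kernel):
`E(x₀,x_j) = N(x₀,x_j) = 0` (`j = 1..4`) and `M(x₀,x₁) = 0`. -/
theorem pointWitness_kills_config :
    (∀ j : Fin 5, j ≠ 0 → (∑ a : Fin 5, ∑ b : Fin 5, sE a b * xw 0 a * xw j b) = 0 ∧ (∑ a : Fin 5, ∑ b : Fin 5, sN a b * xw 0 a * xw j b) = 0) ∧
    (∑ a : Fin 5, ∑ b : Fin 5, sM a b * xw 0 a * xw 1 b) = 0 := by
  decide

set_option maxHeartbeats 4000000 in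
/-- … and `perm x = ⟨x₀ ⊗ x₁ ⊗ x₂ ⊗ x₃ ⊗ x₄, P₅⟩ = 18 ≠ 0` (kernel).  Evaluating an honest identity `P₅ = Σ u_t ⊗ w_t` at the point
`(x₀,…,x₄)` would give `18 = Σ_t u_t(x_{S_t}) · w_t(x_{S_tᶜ}) = 0`: a decomposable apolar witness. -/
theorem pointWitness_perm :
    (∑ a : Fin 5, ∑ b : Fin 5, ∑ c : Fin 5, ∑ d : Fin 5, ∑ e : Fin 5, pat5 a b c d e * (xw 0 a * xw 1 b * xw 2 c * xw 3 d * xw 4 e)) = 18 := by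
  decide

/-! ### 4. The ledger of p629937: the honest hub expansion of weight 144 -/

set_option maxHeartbeats 4000000 in
/-- HUB EXPANSION (kernel): `P₅ = Σ_{j=1}^{4} (E₀ⱼ ⊗ R + N₀ⱼ ⊗ U + M₀ⱼ ⊗ Q)` (long factors read the three remaining slots in
increasing order) — twelve honest pair terms, weight `144`.  The border family of p629937 keeps the nine generators
`E₀ⱼ, N₀ⱼ (j = 1..4), M₀₁` (cost `108`) and replaces `M₀₂, M₀₃, M₀₄` (cost `36`) by the cubic ghosts `M₀ⱼ ⊗ e₃⁽¹⁾, …` of the flat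
limit: `108 = 144 − 36`, the price being that the limit ideal is no longer generated by a configuration. -/
theorem hub_expansion_144 : ∀ a b c d e : Fin 5,
    (sE a b * arrR c d e + sN a b * arrU c d e + sM a b * arrQ c d e) +
    (sE a c * arrR b d e + sN a c * arrU b d e + sM a c * arrQ b d e) +
    (sE a d * arrR b c e + sN a d * arrU b c e + sM a d * arrQ b c e) +
    (sE a e * arrR b c d + sN a e * arrU b c d + sM a e * arrQ b c d) = pat5 a b c d e := by
  decide

/-! ### 5. Sign-sensitivity of apolar witnesses -/

/-- `θ = e₄` read in slot `0` (the slice generator of the weight-72 `D₅` configuration of `sign_five_cheap`). -/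
def th (a : Fin 5) : ℤ := if a = 4 then 1 else 0
/-- the standard symplectic `ω` (`ω(0,1) = 1 = ω(2,3)`, antisymmetric) — the pair generators `ω₀ⱼ`. -/
def om (a b : Fin 5) : ℤ :=
  if a = 0 ∧ b = 1 then 1 else if a = 1 ∧ b = 0 then -1 else if a = 2 ∧ b = 3 then 1 else if a = 3 ∧ b = 2 then -1 else 0
/-- the inline Levi-Civita symbol (`D₅` on permutations, `0` elsewhere), as in `…Negative.SignPatternCheap`. -/
def levi (a b c d e : Fin 5) : ℤ :=
  (if a < b then 1 else if b < a then -1 else 0) * (if a < c then 1 else if c < a then -1 else 0) * (if a < d then 1 else if d < a then -1 else 0) *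
  (if a < e then 1 else if e < a then -1 else 0) * (if b < c then 1 else if c < b then -1 else 0) * (if b < d then 1 else if d < b then -1 else 0) *
  (if b < e then 1 else if e < b then -1 else 0) * (if c < d then 1 else if d < c then -1 else 0) * (if c < e then 1 else if e < c then -1 else 0) *
  (if d < e then 1 else if e < d then -1 else 0)
/-- the apolar witness `φ₂ = [v injective ∧ v₀ ≠ 4]`. -/
def phi2 (a b c d e : Fin 5) : ℤ := if a ≠ 4 then pat5 a b c d e else 0

/-- `φ₂` kills the degree-𝟙 part of the `D₅` configuration ideal `(θ₀; ω₀₁, ω₀₂, ω₀₃, ω₀₄)` (kernel): `φ₂ ⊥ θ₀ ⊗ V^{⊗4}` and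
`φ₂ ⊥ ω₀ⱼ ⊗ V^{⊗3}`. -/
theorem phi2_perp :
    (∀ b c d e : Fin 5, (∑ a : Fin 5, phi2 a b c d e * th a) = 0) ∧
    (∀ c d e : Fin 5, (∑ a : Fin 5, ∑ b : Fin 5, phi2 a b c d e * om a b) = 0) ∧
    (∀ b d e : Fin 5, (∑ a : Fin 5, ∑ c : Fin 5, phi2 a b c d e * om a c) = 0) ∧
    (∀ b c e : Fin 5, (∑ a : Fin 5, ∑ d : Fin 5, phi2 a b c d e * om a d) = 0) ∧
    (∀ b c d : Fin 5, (∑ a : Fin 5, ∑ e : Fin 5, phi2 a b c d e * om a e) = 0) := by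
  decide

set_option maxHeartbeats 4000000 in
/-- … pairs to `96 ≠ 0` with `P₅` (kernel): `P₅ ∉ (θ₀; ω₀ⱼ)_𝟙` although `D₅ ∈ (θ₀; ω₀ⱼ)_𝟙` (`sign_five_hub_identity` ✓):
the SAME weight-72 configuration ideal separates the permanent pattern from the determinant pattern, so apolar witnesses are
sign-sensitive by construction (cf. `…Negative.SignBlindBarrier.signBlind_le_72`). -/
theorem phi2_pairs_P5 : (∑ a : Fin 5, ∑ b : Fin 5, ∑ c : Fin 5, ∑ d : Fin 5, ∑ e : Fin 5, phi2 a b c d e * pat5 a b c d e) = 96 := by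
  decide

set_option maxHeartbeats 4000000 in
/-- … and to `0` with the Levi-Civita symbol (kernel), as it must. -/
theorem phi2_pairs_levi : (∑ a : Fin 5, ∑ b : Fin 5, ∑ c : Fin 5, ∑ d : Fin 5, ∑ e : Fin 5, phi2 a b c d e * levi a b c d e) = 0 := by
  decide

/-! ### 6. Ghosts are born on rank strata (proved over `ℂ`) -/

/-- **Cubic collision ⇒ low rank.**  Short spaces `span p ⊆ V_h ⊗ V_i` (split `{h,i}`) and `span q ⊆ V_h ⊗ V_j` (split `{h,j}`);
a non-zero element of `(span p)·V_j ∩ (span q)·V_i ⊆ V_h ⊗ V_i ⊗ V_j` (a cubic collision, i.e. a drop of the Hilbert function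
of the configuration ideal in degree `{h,i,j}`) forces `span p` to contain a non-zero matrix of rank `≤ #q`
(contract the colliding cubic with a suitable letter in the slot `j`). -/
theorem cubicGhost_rank (m m' : ℕ) (p : Fin m → Fin 5 → Fin 5 → ℂ) (q : Fin m' → Fin 5 → Fin 5 → ℂ)
    (x : Fin m → Fin 5 → ℂ) (y : Fin m' → Fin 5 → ℂ)
    (hne : ∃ a b c, (∑ k, p k a b * x k c) ≠ 0)
    (hcoll : ∀ a b c, (∑ k, p k a b * x k c) = ∑ l, q l a c * y l b) :
    ∃ (coef : Fin m → ℂ) (A : Fin m' → Fin 5 → ℂ) (Y : Fin m' → Fin 5 → ℂ),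
      (∃ a b, (∑ k, coef k * p k a b) ≠ 0) ∧ ∀ a b, (∑ k, coef k * p k a b) = ∑ l, A l a * Y l b := by
  obtain ⟨a, b, c, h⟩ := hne
  refine ⟨fun k => x k c, fun l a' => q l a' c, fun l => y l, ⟨a, b, ?_⟩, ?_⟩
  · simpa [mul_comm] using h
  · intro a' b'
    have h' := hcoll a' b' c
    simpa [mul_comm] using h'

/-! ### 7. The gateway of the line: apolar witnesses -/

/-- The contraction condition `u_t ⌟ Φ = 0`: for every word `v`, the sum of `u t v' * Φ v'` over the words `v'` that agree with
`v` OFF the slots `S t` vanishes (i.e. `Φ ⊥ u_t ⊗ R_{(S t)ᶜ}`, equivalently `u_t ∈ Ann(Φ)`: `J ⊆ Ann Φ` generator-wise). -/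
def Apolar {N : ℕ} (T : Finset (Fin N)) (S : Fin N → Finset (Fin 5)) (u : Fin N → (Fin 5 → Fin 5) → ℂ)
    (Φ : (Fin 5 → Fin 5) → ℂ) : Prop :=
  ∀ t ∈ T, ∀ v : Fin 5 → Fin 5,
    (∑ v' ∈ (Finset.univ.filter fun v' : Fin 5 → Fin 5 => ∀ i, i ∉ S t → v' i = v i), u t v' * Φ v') = 0

/-- `⟨Φ, P₅⟩` = the sum of `Φ` over the injective words. -/
def pairP5 (Φ : (Fin 5 → Fin 5) → ℂ) : ℂ := ∑ v ∈ (Finset.univ.filter fun v : Fin 5 → Fin 5 => Function.Injective v), Φ v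

/-- canonical representative of the fibre of `v` over the slots outside `A`: overwrite the slots of `A` by the letter `0`. -/
def proj (A : Finset (Fin 5)) (v : Fin 5 → Fin 5) : Fin 5 → Fin 5 := fun i => if i ∈ A then 0 else v i

theorem proj_agree (A : Finset (Fin 5)) (v : Fin 5 → Fin 5) : ∀ i, i ∉ A → proj A v i = v i := by
  intro i hi; simp [proj, hi]

theorem proj_idem (A : Finset (Fin 5)) (v : Fin 5 → Fin 5) : proj A (proj A v) = proj A v := by
  funext i; by_cases hi : i ∈ A <;> simp [proj, hi]

theorem proj_eq_of_agree (A : Finset (Fin 5)) (v v' : Fin 5 → Fin 5) (h : ∀ i, i ∉ A → v' i = v i) :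
    proj A v' = proj A v := by
  funext i; by_cases hi : i ∈ A
  · simp [proj, hi]
  · simp [proj, hi, h i hi]

/-- **Witnesses ⇒ the crux** (PROVED; the direction a prover uses).  If every cheap family of cylindrical short factors admits
an apolar witness `Φ` with `⟨Φ, P₅⟩ ≠ 0`, then `LaplaceOptimalFive` holds: pair an exact identity `Σ_t u_t w_t = P₅` against `Φ`
fibre by fibre (the long factor is constant on each fibre over `(S t)ᶜ`, the short contraction vanishes there). -/
theorem laplaceOptimalFive_of_witnesses
    (h : ∀ (N : ℕ) (T : Finset (Fin N)) (S : Fin N → Finset (Fin 5)) (u : Fin N → (Fin 5 → Fin 5) → ℂ),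
      (∀ t, ∀ v v' : Fin 5 → Fin 5, (∀ i ∈ S t, v i = v' i) → u t v = u t v') →
      (∑ t ∈ T, (S t).card.factorial * (5 - (S t).card).factorial) < Nat.factorial 5 →
      ∃ Φ : (Fin 5 → Fin 5) → ℂ, Apolar T S u Φ ∧ pairP5 Φ ≠ 0) :
    Summit.ValiantsHypothesis.ValiantsHypothesis.Theses.RigidityForcesSymmetry.LaplaceOptimalFive := by
  classical
  unfold Summit.ValiantsHypothesis.ValiantsHypothesis.Theses.RigidityForcesSymmetry.LaplaceOptimalFive
  intro N T S u w hu hw hid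
  by_contra hlt
  push Not at hlt
  obtain ⟨Φ, hker, hpair⟩ := h N T S u hu hlt
  apply hpair
  -- `⟨Φ, P₅⟩ = Σ_v (Σ_t u_t v w_t v) Φ v`
  have key : pairP5 Φ = ∑ v : Fin 5 → Fin 5, (∑ t ∈ T, u t v * w t v) * Φ v := by
    unfold pairP5
    rw [Finset.sum_filter]
    refine Finset.sum_congr rfl (fun v _ => ?_)
    rw [hid v]
    split_ifs <;> simp
  rw [key]
  -- swap the sums and kill each term fibrewise
  have swap : (∑ v : Fin 5 → Fin 5, (∑ t ∈ T, u t v * w t v) * Φ v) = ∑ t ∈ T, ∑ v : Fin 5 → Fin 5, u t v * w t v * Φ v := by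
    rw [Finset.sum_comm]
    refine Finset.sum_congr rfl (fun v _ => ?_)
    rw [Finset.sum_mul]
  rw [swap]
  refine Finset.sum_eq_zero (fun t ht => ?_)
  -- partition the words by their projection off `S t`
  rw [← Finset.sum_fiberwise_of_maps_to (s := (Finset.univ : Finset (Fin 5 → Fin 5))) (t := (Finset.univ : Finset (Fin 5 → Fin 5)))
        (g := proj (S t)) (fun x _ => Finset.mem_univ _)]
  refine Finset.sum_eq_zero (fun y _ => ?_)
  by_cases hy : proj (S t) y = y
  · -- the fibre is exactly the set of words agreeing with `y` off `S t`; the long factor is constant `= w t y` there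
    have hset : (Finset.univ.filter fun x : Fin 5 → Fin 5 => proj (S t) x = y)
        = (Finset.univ.filter fun v' : Fin 5 → Fin 5 => ∀ i, i ∉ S t → v' i = y i) := by
      ext x
      simp only [Finset.mem_filter, Finset.mem_univ, true_and]
      constructor
      · intro hx i hi
        have := proj_agree (S t) x i hi
        rw [hx] at this
        exact this.symm
      · intro hx
        rw [proj_eq_of_agree (S t) y x hx, hy]
    rw [hset]
    have hconst : ∀ x ∈ (Finset.univ.filter fun v' : Fin 5 → Fin 5 => ∀ i, i ∉ S t → v' i = y i),
        u t x * w t x * Φ x = w t y * (u t x * Φ x) := by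
      intro x hx
      simp only [Finset.mem_filter, Finset.mem_univ, true_and] at hx
      have hwx : w t x = w t y := hw t x y (fun i hi => hx i hi)
      rw [hwx]; ring
    rw [Finset.sum_congr rfl hconst, ← Finset.mul_sum, hker t ht y, mul_zero]
  · -- empty fibre
    have hset : (Finset.univ.filter fun x : Fin 5 → Fin 5 => proj (S t) x = y) = ∅ := by
      ext x
      simp only [Finset.mem_filter, Finset.mem_univ, true_and, Finset.notMem_empty, iff_false]
      intro hx
      apply hy
      rw [← hx, proj_idem]
    rw [hset, Finset.sum_empty]

/-- **The converse** (stub; Hahn–Banach / finite-dimensional duality in `ℂ^{3125}`, M-sized): if `LaplaceOptimalFive` holds then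
every cheap cylindrical short configuration admits an apolar witness.  Together with `laplaceOptimalFive_of_witnesses` this is
the apolar-witness form of the crux: a proof of the crux is a UNIFORM construction `u ↦ Φ_u`; §§2, 3, 5 are instances, and the
border classes are exactly where every candidate witness degenerates while `β₀` of the limit ideal jumps. -/
theorem stub_witnesses_of_laplaceOptimalFive
    (h : Summit.ValiantsHypothesis.ValiantsHypothesis.Theses.RigidityForcesSymmetry.LaplaceOptimalFive) :
    ∀ (N : ℕ) (T : Finset (Fin N)) (S : Fin N → Finset (Fin 5)) (u : Fin N → (Fin 5 → Fin 5) → ℂ),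
      (∀ t, ∀ v v' : Fin 5 → Fin 5, (∀ i ∈ S t, v i = v' i) → u t v = u t v') →
      (∑ t ∈ T, (S t).card.factorial * (5 - (S t).card).factorial) < Nat.factorial 5 →
      ∃ Φ : (Fin 5 → Fin 5) → ℂ, Apolar T S u Φ ∧ pairP5 Φ ≠ 0 := by
  sorry

end Summit.ValiantsHypothesis.ValiantsHypothesis.Cruxes.LaplaceOptimalFive.GhostLedger
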